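import Summits.MatrixMultiplication.OmegaCensus.STPPVosperSlackOneA2CoverRowsZ61A
import Summits.MatrixMultiplication.OmegaCensus.STPPVosperSlackOneA2CoverRowsZ61B
import Summits.MatrixMultiplication.OmegaCensus.STPPVosperSlackOneA2CoverRowsZ61C
import Summits.MatrixMultiplication.OmegaCensus.STPPVosperSlackOneA2CoverRowsZ61D
import Summits.MatrixMultiplication.OmegaCensus.STPPVosperSlackOneBetaTableZ61_50
import Summits.MatrixMultiplication.OmegaCensus.STPPVosperSlackOneKillsZ61C

/-!
# ω-census (abelian STPP census): `{(2,4,4),(2,4,4)}` has no STPP family in `ℤ₆₁` — slack-1 law with the exact-cover stage (kernel, UNCONDITIONAL)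

HONEST FRAMING (pub-omega census; verbatim): lottery ticket; floor = certified bounds/negative ranges.
Census STRUCTURE (seat pub-omega-stpp-1 gen 31, 2026-08-28), family (b2).  The pattern `{(2,4,4),(2,4,4)}` at order `61` was kernel-open after stpp-1 g30:
in the reading `(a,b,c) = (2,4,4)` the slack-1 chain is `8 + 4 + 32 + 2 + 16 = 62 = p + 1`, the tight-type and case-β tables are clean, but the case-α₂
window table has survivors (ratio `±6`).  Those survivors die at the EXACT-COVER stage: the second block `(2,4,4)` cannot realise `C − B = Y°` (two runs)
and `C − A = Z°` (a progression) exactly (`a2CoverRow_61_244_rows_6_7`, `…_55_56`).  This file assembles the rows, the tight-type table and the case-β table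
and applies `no_isSTPP_of_slack_one_tables_prime_a2_coverSpec`.  UNCONDITIONAL (the Hamidoune–Rødseth input of case β is the tree theorem
`hamidouneRodsethInverseTheorem_holds`).  Nothing here is progress on `ω`.

References: Y. O. Hamidoune, Ø. J. Rødseth, Acta Arith. 92 (2000) 251–262; A. G. Vosper, J. London Math. Soc. 31 (1956); M. B. Nathanson, GTM 165,
Thm 2.7; H. Cohn, R. Kleinberg, B. Szegedy, C. Umans, FOCS 2005 (arXiv:math/0511460), Def. 5.1.
-/

open Finset
open scoped Pointwise

namespace Summit.MatrixMultiplication.OmegaCensus.CubeNB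

open Literature.Computability.AlgebraicComplexity
open Literature.Combinatorics.Additive
open Summit.MatrixMultiplication.OmegaCensus.STPPKneser

/-! ## Tables -/

section Tables

/-- Tight-type table `(n, m, r) = (49, 17, 4)` at `61` with target `{0, ±1, ±2, ±3}`. [folklore] -/
theorem table_49_17_4_a2b4 : ∀ j < 61, ∀ t < 61, (∀ i < 17, (t + j * i) % 61 < 49) →
    (∀ k < 17, 4 ∣ (t + j * k) % 61 - #((range 17).filter fun i => (t + j * i) % 61 < (t + j * k) % 61)) →
    j ∈ ({0, 1, 60, 2, 59, 3, 58} : Finset ℕ) := by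
  decide +kernel

/-- **All rows of the case-α₂ cover table for `(2,4,4)² ⊆ ℤ₆₁`** (assembled from `STPPVosperSlackOneA2CoverRowsZ61{A,B,C,D}.lean`). [folklore] -/
theorem a2CoverRow_61_244_all : ∀ j < 61, a2CoverRow 61 50 16 4 {0, 1, 60, 2, 59, 3, 58} 8 [(2, 4, 4)] j = true := by
  intro j hj
  by_cases h0 : j < 6
  · exact List.all_eq_true.1 a2CoverRow_61_244_rows_0_6 j (List.mem_range'_1.2 ⟨by omega, by omega⟩)
  by_cases h1 : j < 7
  · exact List.all_eq_true.1 a2CoverRow_61_244_rows_6_7 j (List.mem_range'_1.2 ⟨by omega, by omega⟩)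
  by_cases h2 : j < 30
  · exact List.all_eq_true.1 a2CoverRow_61_244_rows_7_30 j (List.mem_range'_1.2 ⟨by omega, by omega⟩)
  by_cases h3 : j < 55
  · exact List.all_eq_true.1 a2CoverRow_61_244_rows_30_55 j (List.mem_range'_1.2 ⟨by omega, by omega⟩)
  by_cases h4 : j < 56
  · exact List.all_eq_true.1 a2CoverRow_61_244_rows_55_56 j (List.mem_range'_1.2 ⟨by omega, by omega⟩)
  exact List.all_eq_true.1 a2CoverRow_61_244_rows_56_61 j (List.mem_range'_1.2 ⟨by omega, by omega⟩)

end Tables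

/-! ## The kill -/

section Kills

/-- **`{(2,4,4),(2,4,4)}` has no STPP family in `ℤ₆₁`** — UNCONDITIONAL (slack-1 law at block `0` in the reading `(a,b,c) = (2,4,4)`,
`(z, b, vol, a, L) = (8, 4, 32, 2, 16)`, `(m, n) = (17, 49)`; case γ by the tight-type table, case β by `tableBeta_61_50_17_4`, case α₂ by the cover-stage
rows `a2CoverRow_61_244_all`).  OMEGA-TABLE NR258 leaf.
[cite: CohnKleinbergSzegedyUmans2005, Def. 5.1] [cite: Vosper1956, main theorem; Nathanson1996, Thm 2.7]
[cite: HamidouneRodseth2000, main theorem (§1, p. 252)] -/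
theorem no_isSTPP_zmod61_244_244_kernel (A B C : Fin 2 → Finset (ZMod 61)) (hS : IsSTPP A B C)
    (hA : ∀ i, #(A i) = ![2, 2] i) (hB : ∀ i, #(B i) = ![4, 4] i) (hC : ∀ i, #(C i) = ![4, 4] i) : False := by
  haveI : Fact (Nat.Prime 61) := ⟨prime_61⟩
  have hAne : ∀ i, (A i).Nonempty := fun i => card_pos.1 (by rw [hA]; fin_cases i <;> simp)
  have hBne : ∀ i, (B i).Nonempty := fun i => card_pos.1 (by rw [hB]; fin_cases i <;> simp)
  have hCne : ∀ i, (C i).Nonempty := fun i => card_pos.1 (by rw [hC]; fin_cases i <;> simp)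
  have e0 : (univ : Finset (Fin 2)).erase 0 = {1} := by decide
  have hz : ∑ k ∈ (univ : Finset (Fin 2)).erase 0, #(A k) * #(C k) = 8 := by
    rw [e0, Finset.sum_singleton]; simp [hA, hC]
  have hL : ∑ k ∈ (univ : Finset (Fin 2)).erase 0, #(B k) * #(C k) = 16 := by
    rw [e0, Finset.sum_singleton]; simp [hB, hC]
  have ha : #(A 0) = 2 := by rw [hA]; simp
  have hb : #(B 0) = 4 := by rw [hB]; simp
  have hvol : #(A 0) * #(B 0) * #(C 0) = 32 := by rw [hA, hB, hC]; simp
  have hsz : (([1] : List (Fin 2)).map fun k => (#(A k), #(B k), #(C k))) = [(2, 4, 4)] := by simp [hA, hB, hC]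
  exact no_isSTPP_of_slack_one_tables_prime_a2_coverSpec A B C hS hAne hBne hCne 0 ⟨1, by decide⟩ [1] (by decide)
    (fun k => by fin_cases k <;> decide) ha hb hvol hz hL rfl (by norm_num) (by norm_num) (by norm_num) (by norm_num) (m := 17) (n := 49) rfl rfl
    target_61_a2_b4 table_49_17_4_a2b4
    (fun j hj ℓ₁ h1 h2 t₁ ht₁ t₂ ht₂ hw1 hw2 hnd hpre => by
      rw [hsz]; exact a2CoverRow_spec (a2CoverRow_61_244_all j hj) ℓ₁ h1 h2 t₁ ht₁ t₂ ht₂ hw1 hw2 hnd hpre)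
    tableBeta_61_50_17_4

end Kills

end Summit.MatrixMultiplication.OmegaCensus.CubeNB
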